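import Literature.NumberTheory.Automorphic.GLOneStandardLTate
import Literature.NumberTheory.Automorphic.AutomorphicGaloisConj
import Literature.NumberTheory.Automorphic.ClassFieldCharacter
import Mathlib.RingTheory.SimpleModule.Rank
import HarnessLib

/-!
# Hecke characters as cuspidal automorphic representations of `GL_1(𝔸_K)` (proofs)

Topic `NumberTheory/Automorphic`; namespace `Literature.NumberTheory.Automorphic` (dot-notation
lemmas in `GLOne` and `CuspidalAutomorphicRepGL`). A proof file (theorems only: no definition, no
named fact, no instance), converse companion to `GLOneStandardLTate`: there, every cuspidal
automorphic representation `Π` of `GL_1(𝔸_K)` in the tree's honest `L²` model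
(`CuspidalAutomorphicRepGL 1 K μ`, an irreducible closed subrepresentation of
`L²_cusp(GL_1(𝔸_K) ⧸ ℝ_{>0} GL_1(K)) = L²`) was shown to be a line with a unitary Hecke character
`χ_Π` (`CuspidalAutomorphicRepGL.heckeCharacter`), whose honest Satake parameters are the values
`{χ_Π(ϖ_v)}`. Here:

* `GLOne.hasSatakeParameterAt_of_mem_fixedVectors` — **existence of Satake parameters in rank
  one**: a non-zero `Kf`-fixed vector of an irreducible `W ≤ L²(GL_1)` is a Hecke eigenvector at
  every finite place `v`, for *every* uniformizer `ϖ`, with parameter `{χ_W(⟨ϖ⟩_v)}`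
  (`T_{v,1} = R(t_{v,1})` in rank one, `GLOne.heckeOperatorAt_eq_toContRep_apply`).
* `GLOne.exists_cuspidalAutomorphicRepGL_of_eigenvector` — **an `L²`-eigenline in `L²_cusp(GL_1)`
  is a cuspidal automorphic representation**: a non-zero `f₀ ∈ L²_cusp` with `R(g) f₀ = c(g) f₀`
  spans an irreducible closed invariant line, of eigencharacter `c`.
* `GLOne.exists_cuspidalAutomorphicRepGL_of_automorphicCharacter`,
  `CuspidalAutomorphicRepGL.exists_heckeCharacter_eq` — **every unitary Hecke character `θ` of `K`
  trivial on `ℝ_{>0}` (e.g. of finite order) is the Hecke character of a cuspidal automorphic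
  representation of `GL_1(𝔸_K)`**, namely the line `ℂ · [y ↦ θ(det y)⁻¹]`, which has non-zero
  vectors fixed by every level `Kf` on which `θ ∘ det` is trivial. Together with
  `heckeCharacter_injective` (`StrongMultiplicityOneGLOne`) this is the Hecke–Tate dictionary
  "automorphic representations of `GL(1)` = idèle class characters" (Jacquet–Langlands 1970, §9,
  §12; Gelbart 1975, §2.A and §6.A; Arthur–Clozel 1989, Introduction p. xii and Ch. 3 §6, where
  `π_E` is an idèle class character of `E` viewed on `GL(1, 𝔸_E)`).
* `GLOne.eigenvalue_galConj`, `CuspidalAutomorphicRepGL.heckeCharacter_galConj_apply` — **the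
  Galois conjugate `U_σ(Π)` of a cuspidal `Π` of `GL_1(𝔸_E)` has Hecke character `x ↦ χ_Π(σ⁻¹ x)`**
  (`U_σ R(g) = R(σ g) U_σ`, `galL2_rightRegular`; Arthur–Clozel, Ch. 1 §2.1, `Π^σ`), and
  `exists_mem_fixedVectors_galConj` — `U_σ` carries `K(𝔑)`-fixed vectors to `K(𝔑)`-fixed vectors
  for a `Gal`-stable level `𝔑`.

These are the rank-one inputs of Arthur–Clozel's proof of automorphic induction (Ch. 3, Thm. 6.2
from Thm. 4.2 (e): `π_E = ω`, an idèle class character, and its conjugates `ω^{σ^i}`).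

## References

* H. Jacquet, R. P. Langlands, *Automorphic Forms on GL(2)*, LNM 114 (1970), §9, §12.
  [JacquetLanglands1970]
* S. Gelbart, *Automorphic forms on adele groups*, Ann. of Math. Stud. 83 (1975), §2.A, §6.A.
  [Gelbart1975]
* J. Arthur, L. Clozel, *Simple algebras, base change, and the advanced theory of the trace
  formula*, Ann. of Math. Stud. 120 (1989), Introduction p. xii; Ch. 1 §2.1; Ch. 3 §6.
  [ArthurClozelAMS120]
-/

noncomputable section

open scoped MatrixGroups Pointwise
open NumberField IsDedekindDomain MeasureTheory

namespace Literature.NumberTheory.Automorphic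

open AdelicGroupData

/-! ### Satake parameters of an irreducible `W ≤ L²(GL_1)` from a fixed vector -/

section Satake

variable {K : Type} [Field K] [NumberField K]
  {μ : Measure (gl 1 K).automorphicQuotient} [(gl 1 K).IsAutomorphicMeasure μ]
  {W : ContRepresentation.ClosedSubrep ((gl 1 K).rightRegular μ)}

/-- **Existence of honest Satake parameters in rank one.** If the irreducible `W ≤ L²(GL_1)` has
a non-zero `Kf`-fixed vector `f`, then for every finite place `v` and *every* uniformizer `ϖ` of
`K_v`, `W` has Satake parameter `{χ_W(⟨ϖ⟩_v)}` at `v` with respect to `Kf` and `ϖ`: in rank one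
`T_{v,0} = 1` and `T_{v,1} = [Kf t_{v,1} Kf] = R(t_{v,1})` (`GL_1(𝔸_K)` is commutative), acting on
`W` by the eigenvalue `ω_W(t_{v,1}) = χ_W(⟨ϖ⟩_v)` (Gelbart 1975, §6.A; Jacquet–Langlands 1970, §9).
[folklore] -/
theorem GLOne.hasSatakeParameterAt_of_mem_fixedVectors (hW : W.toContRep.IsTopIrreducible)
    {Kf : Subgroup (GL (Fin 1) (AdeleRing (𝓞 K) K))} {f : W.toSubmodule}
    (hf : f ∈ W.fixedVectors Kf) (hf0 : f ≠ 0) (v : HeightOneSpectrum (𝓞 K))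
    {ϖ : (v.adicCompletion K)ˣ} (hϖ : Valued.v (ϖ : v.adicCompletion K) = WithZero.exp (-1 : ℤ)) :
    HasSatakeParameterAt W Kf v ϖ
      {((GLOne.heckeCharacter hW (GaloisRepresentations.localUnits v ϖ) : ℂˣ) : ℂ)} := by
  refine ⟨hϖ, Multiset.card_singleton _, f, hf, hf0, fun i hi => ?_⟩
  rw [GLOne.heckeOperatorAt_eq_toContRep_apply W Kf _ hf]
  interval_cases i
  · rw [heckeDiagAt_zero]
    change (W.toContRep (1 : (gl 1 K).Adelic)) f = _
    rw [map_one]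
    simp [Multiset.esymm]
  · have he : ({((GLOne.heckeCharacter hW (GaloisRepresentations.localUnits v ϖ) : ℂˣ) : ℂ)} :
        Multiset ℂ).esymm 1 =
        ((GLOne.heckeCharacter hW (GaloisRepresentations.localUnits v ϖ) : ℂˣ) : ℂ) := by
      simp [Multiset.esymm, Multiset.powersetCard_one]
    rw [he, GLOne.heckeDiagAt_one_one_eq_scalar, GLOne.toContRep_apply_eq_eigenvalue_smul hW,
      GLOne.coe_heckeCharacter_apply]
    simp

end Satake

/-! ### An `L²`-eigenline in `L²_cusp(GL_1)` is a cuspidal automorphic representation -/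

section Line

variable {K : Type} [Field K] [NumberField K]
  {μ : Measure (gl 1 K).automorphicQuotient} [(gl 1 K).IsAutomorphicMeasure μ]

/-- **An eigenline of the regular representation inside `L²_cusp(GL_1)` is a cuspidal automorphic
representation of `GL_1(𝔸_K)`.** If `0 ≠ f₀ ∈ L²_cusp(GL_1(𝔸_K) ⧸ ℝ_{>0} GL_1(K))` satisfies
`R(g) f₀ = c(g) f₀` for all `g`, then the line `ℂ f₀` is a closed (finite-dimensional), invariant,
topologically irreducible (one-dimensional) subspace of `L²_cusp`, i.e. a cuspidal automorphic
representation `Π` with `f₀ ∈ Π = ℂ f₀` and eigencharacter `ω_Π = c` (Gelbart 1975, §2.A: the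
irreducible constituents of `L²(GL_1(K) \ GL_1(𝔸))` are the lines spanned by the characters).
[folklore] -/
theorem GLOne.exists_cuspidalAutomorphicRepGL_of_eigenvector {f₀ : (gl 1 K).L2 μ} (hf₀ : f₀ ≠ 0)
    (hcusp : f₀ ∈ cuspidalSubspace 1 K μ) {c : (gl 1 K).Adelic → ℂ}
    (heig : ∀ g, (gl 1 K).rightRegular μ g f₀ = c g • f₀) :
    ∃ P : CuspidalAutomorphicRepGL 1 K μ, f₀ ∈ P.1 ∧ (∀ f : (gl 1 K).L2 μ, f ∈ P.1 ↔ f ∈ ℂ ∙ f₀) ∧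
      ∀ g, GLOne.eigenvalue P.isTopIrreducible g = c g := by
  haveI hfd : FiniteDimensional ℂ (ℂ ∙ f₀) :=
    FiniteDimensional.span_of_finite ℂ (Set.finite_singleton f₀)
  let W : ContRepresentation.ClosedSubrep ((gl 1 K).rightRegular μ) :=
    { toSubmodule := ℂ ∙ f₀
      apply_mem_toSubmodule := fun g f hf => by
        obtain ⟨a, rfl⟩ := Submodule.mem_span_singleton.1 hf
        change (gl 1 K).rightRegular μ g (a • f₀) ∈ ℂ ∙ f₀
        rw [map_smul, heig g, smul_smul]
        exact Submodule.smul_mem _ _ (Submodule.mem_span_singleton_self f₀)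
      isClosed' := (ℂ ∙ f₀).closed_of_finiteDimensional }
  have hmemW : ∀ f : (gl 1 K).L2 μ, f ∈ W ↔ f ∈ ℂ ∙ f₀ := fun f => Iff.rfl
  have hf₀W : f₀ ∈ W := (hmemW f₀).2 (Submodule.mem_span_singleton_self f₀)
  -- irreducibility: `ℂ f₀` is one-dimensional
  have hirr : W.toContRep.IsTopIrreducible := by
    rw [ContRepresentation.isTopIrreducible_iff]
    have hrank : Module.finrank ℂ (ℂ ∙ f₀) = 1 := finrank_span_singleton hf₀
    haveI hsm : IsSimpleModule ℂ (ℂ ∙ f₀) := isSimpleModule_iff_finrank_eq_one.2 hrank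
    refine ⟨⟨⟨⟨f₀, Submodule.mem_span_singleton_self f₀⟩, 0, fun h => hf₀ ?_⟩⟩, fun W' => ?_⟩
    · exact congrArg Subtype.val h
    · rcases eq_bot_or_eq_top (W'.toSubmodule : Submodule ℂ (ℂ ∙ f₀)) with h | h
      · left
        refine SetLike.ext' ?_
        change ((W'.toSubmodule : Submodule ℂ (ℂ ∙ f₀)) : Set (ℂ ∙ f₀)) =
          (((⊥ : ContRepresentation.ClosedSubrep W.toContRep).toSubmodule :
            Submodule ℂ (ℂ ∙ f₀)) : Set (ℂ ∙ f₀))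
        rw [h, ContRepresentation.ClosedSubrep.toSubmodule_bot]
      · right
        refine SetLike.ext' ?_
        change ((W'.toSubmodule : Submodule ℂ (ℂ ∙ f₀)) : Set (ℂ ∙ f₀)) =
          (((⊤ : ContRepresentation.ClosedSubrep W.toContRep).toSubmodule :
            Submodule ℂ (ℂ ∙ f₀)) : Set (ℂ ∙ f₀))
        rw [h, ContRepresentation.ClosedSubrep.toSubmodule_top]
  -- cuspidality: `ℂ f₀ ≤ L²_cusp`
  have hle : W ≤ cuspidalSubspace 1 K μ := by
    intro f hf
    obtain ⟨a, rfl⟩ := Submodule.mem_span_singleton.1 ((hmemW f).1 hf)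
    exact (cuspidalSubspace 1 K μ).toSubmodule.smul_mem a hcusp
  refine ⟨⟨W, hle, hirr⟩, hf₀W, hmemW, fun g => ?_⟩
  -- the eigencharacter is `c`
  have key := GLOne.toContRep_apply_eq_eigenvalue_smul (W := W) hirr g ⟨f₀, hf₀W⟩
  have key' := congrArg Subtype.val key
  change (gl 1 K).rightRegular μ g f₀ = GLOne.eigenvalue hirr g • f₀ at key'
  rw [heig g] at key'
  exact (smul_left_injective ℂ hf₀ key').symm

/-- **The line `ℂ ψ̄` of an automorphic character.** For a unitary automorphic character `ψ` of
`GL_1(𝔸_K)` (a continuous unitary character trivial on `ℝ_{>0} · GL_1(K)`), the class of the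
bounded continuous function `ψ̄` on the (finite-volume) automorphic quotient is a non-zero vector of
`L² = L²_cusp(GL_1)` (no proper parabolics in rank one) with `R(g) [ψ̄] = ψ(g)⁻¹ [ψ̄]`
(`ψ̄(g⁻¹ x) = ψ(g)⁻¹ ψ̄(x)`); hence it spans a cuspidal automorphic representation `Π` of
`GL_1(𝔸_K)` with eigencharacter `ω_Π = ψ⁻¹`, containing non-zero vectors fixed by every subgroup
`Kf` on which `ψ` is trivial (Gelbart 1975, §2.A, §6.A; Jacquet–Langlands 1970, §9). [folklore] -/
theorem GLOne.exists_cuspidalAutomorphicRepGL_of_automorphicCharacter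
    (ψ : (gl 1 K).AutomorphicCharacter) :
    ∃ P : CuspidalAutomorphicRepGL 1 K μ,
      (∀ g, GLOne.eigenvalue P.isTopIrreducible g = ((ψ g : ℂˣ) : ℂ)⁻¹) ∧
      ∀ Kf : Subgroup (GL (Fin 1) (AdeleRing (𝓞 K) K)), (∀ k ∈ Kf, ψ k = 1) →
        ∃ f ∈ P.1.fixedVectors Kf, f ≠ 0 := by
  -- the `L²` class of `ψ̄`
  have hmem : MemLp ψ.quotientFun 2 μ :=
    MemLp.of_bound (ψ.aestronglyMeasurable_quotientFun μ) 1
      (Filter.Eventually.of_forall fun x => (ψ.norm_quotientFun x).le)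
  have hcuspform : IsContinuousCuspForm 1 K μ ψ.quotientFun :=
    ⟨ψ.continuous_quotientFun, hmem, fun k hk hk1 => absurd hk1 (by omega)⟩
  have hf₀cusp : hmem.toLp ψ.quotientFun ∈ cuspidalSubspace 1 K μ :=
    mem_cuspidalSubspace_of_isContinuousCuspForm hcuspform
  have hcoe : (hmem.toLp ψ.quotientFun : (gl 1 K).automorphicQuotient → ℂ) =ᵐ[μ] ψ.quotientFun :=
    MemLp.coeFn_toLp hmem
  -- `[ψ̄] ≠ 0`: `|ψ̄| = 1` everywhere and `μ ≠ 0`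
  have hf₀ : hmem.toLp ψ.quotientFun ≠ 0 := by
    intro h0
    have hae : ψ.quotientFun =ᵐ[μ] (0 : (gl 1 K).automorphicQuotient → ℂ) := by
      rw [← MemLp.toLp_zero (MemLp.zero' (p := 2) (μ := μ))] at h0
      exact (MemLp.toLp_eq_toLp_iff hmem _).1 h0
    have hfalse : ∀ᵐ x ∂μ, False := hae.mono fun x hx => ψ.quotientFun_ne_zero x hx
    have hμ0 : μ = 0 := ae_eq_bot.1 (Filter.eventually_false_iff_eq_bot.1 hfalse)
    have hne : μ Set.univ ≠ 0 :=
      isOpen_univ.measure_ne_zero μ ⟨(gl 1 K).toAutomorphicQuotient 1, trivial⟩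
    exact hne (by rw [hμ0]; rfl)
  -- the eigen-relation `R(g) [ψ̄] = ψ(g)⁻¹ [ψ̄]`
  have heig : ∀ g : (gl 1 K).Adelic, (gl 1 K).rightRegular μ g (hmem.toLp ψ.quotientFun) =
      ((ψ g : ℂˣ) : ℂ)⁻¹ • hmem.toLp ψ.quotientFun := by
    intro g
    refine Lp.ext ?_
    have h1 := (gl 1 K).rightRegular_apply_coeFn μ g (hmem.toLp ψ.quotientFun)
    have h2 : (fun x => (hmem.toLp ψ.quotientFun : (gl 1 K).automorphicQuotient → ℂ) (g⁻¹ • x))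
        =ᵐ[μ] fun x => ψ.quotientFun (g⁻¹ • x) :=
      (measurePreserving_smul g⁻¹ μ).quasiMeasurePreserving.ae_eq_comp hcoe
    have h3 := Lp.coeFn_smul (((ψ g : ℂˣ) : ℂ)⁻¹) (hmem.toLp ψ.quotientFun)
    filter_upwards [h1, h2, h3, hcoe] with x h1 h2 h3 h4
    rw [h1, h2, h3, Pi.smul_apply, h4, smul_eq_mul, ψ.quotientFun_smul, map_inv,
      Units.val_inv_eq_inv_val]
  obtain ⟨P, hf₀P, -, hev⟩ :=
    GLOne.exists_cuspidalAutomorphicRepGL_of_eigenvector hf₀ hf₀cusp heig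
  refine ⟨P, hev, fun Kf hKf => ⟨⟨_, hf₀P⟩, ?_, fun h => hf₀ (congrArg Subtype.val h)⟩⟩
  refine (P.1.mem_fixedVectors Kf _).2 fun k hk => Subtype.ext ?_
  change (gl 1 K).rightRegular μ k (hmem.toLp ψ.quotientFun) = hmem.toLp ψ.quotientFun
  rw [heig k, hKf k hk, Units.val_one, inv_one, one_smul]

/-- `det` of a `1 × 1` scalar matrix is the scalar. [folklore] -/
theorem GeneralLinearGroup.det_scalar_fin_one {R : Type*} [CommRing R] (x : Rˣ) :
    Matrix.GeneralLinearGroup.det (Matrix.GeneralLinearGroup.scalar (Fin 1) x) = x := by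
  rw [Matrix.GeneralLinearGroup.det_scalar, Fintype.card_fin, pow_one]

/-- **Every unitary Hecke character trivial on `ℝ_{>0}` is the Hecke character of a cuspidal
automorphic representation of `GL_1(𝔸_K)`** (the surjectivity half of the Hecke–Tate dictionary
"automorphic representations of `GL(1)` are idèle class characters": Jacquet–Langlands 1970, §9
and §12; Gelbart 1975, §6.A, p. 99; Arthur–Clozel 1989, Introduction p. xii). For `θ` unitary
with `θ(ℝ_{>0}) = 1` (e.g. of finite order, `HeckeCharacter.map_posRealIdele_of_isFiniteOrder`)
there is a cuspidal `Π ≤ L²_cusp(GL_1(𝔸_K) ⧸ ℝ_{>0} GL_1(K))` — the line through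
`[y ↦ θ(det y)⁻¹]` — with `χ_Π = θ`, and with a non-zero vector fixed by every level `Kf` on which
`θ ∘ det` is trivial (such levels `K(𝔪)`, `𝔪 ≠ 0`, exist: `HeckeCharacter.exists_level`).
[cite: Gelbart1975, §6.A (p. 99)] -/
theorem CuspidalAutomorphicRepGL.exists_heckeCharacter_eq
    (θ : GaloisRepresentations.HeckeCharacter K) (hθ : θ.IsUnitary)
    (hθ₀ : ∀ t, θ (posRealIdele K t) = 1) :
    ∃ P : CuspidalAutomorphicRepGL 1 K μ, P.heckeCharacter = θ ∧
      ∀ Kf : Subgroup (GL (Fin 1) (AdeleRing (𝓞 K) K)),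
        (∀ k ∈ Kf, θ (Matrix.GeneralLinearGroup.det k) = 1) → ∃ f ∈ P.1.fixedVectors Kf, f ≠ 0 := by
  obtain ⟨P, hev, hfix⟩ :=
    GLOne.exists_cuspidalAutomorphicRepGL_of_automorphicCharacter (μ := μ) (detChar θ hθ hθ₀)⁻¹
  refine ⟨P, GaloisRepresentations.HeckeCharacter.ext fun x => Units.ext ?_, fun Kf hKf => ?_⟩
  · change ((GLOne.heckeCharacter P.isTopIrreducible x : ℂˣ) : ℂ) = _
    rw [GLOne.coe_heckeCharacter_apply, hev, AutomorphicCharacter.coe_inv_apply, inv_inv,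
      detChar_apply, GeneralLinearGroup.det_scalar_fin_one]
  · exact hfix Kf fun k hk => by
      rw [AutomorphicCharacter.inv_apply, detChar_apply, hKf k hk, inv_one]

end Line

/-! ### Hecke characters and fixed vectors of Galois conjugates in rank one -/

section GalConj

variable (F : Type*) [Field F] {E : Type} [Field E] [NumberField E] [Algebra F E]
  {ν : Measure (gl 1 E).automorphicQuotient} [(gl 1 E).IsAutomorphicMeasure ν]

/-- **The eigencharacter of a Galois conjugate**: for an irreducible `W ≤ L²(GL_1(𝔸_E))` and
`σ ∈ Aut(E/F)`, `U_σ(W)` has eigencharacter `g ↦ ω_W(σ⁻¹ g)` — `U_σ R(σ⁻¹ g) = R(g) U_σ`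
(`galL2_rightRegular`), so `R(g)` acts on `U_σ f`, `f ∈ W`, by `ω_W(σ⁻¹ g)`. This is
`U_σ(W) ≅ W ∘ σ⁻¹` (Arthur–Clozel, Ch. 1 §2.1, in rank one). [folklore] -/
theorem GLOne.eigenvalue_galConj (hν : IsGalInvariant F ν) (σ : E ≃ₐ[F] E)
    {W : ContRepresentation.ClosedSubrep ((gl 1 E).rightRegular ν)}
    (hW : W.toContRep.IsTopIrreducible)
    (hW' : (W.galConj hν σ).toContRep.IsTopIrreducible) (g : (gl 1 E).Adelic) :
    GLOne.eigenvalue hW' g = GLOne.eigenvalue hW (σ⁻¹ • g) := by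
  obtain ⟨f, hf0⟩ := GLOne.exists_ne_zero hW
  have hf' : galL2 F hν σ (f : (gl 1 E).L2 ν) ∈ W.galConj hν σ :=
    (W.galL2_mem_galConj_iff F hν σ).2 f.2
  have hf'0 : galL2 F hν σ (f : (gl 1 E).L2 ν) ≠ 0 := by
    intro h
    apply hf0
    have hn : ‖(f : (gl 1 E).L2 ν)‖ = 0 := by rw [← norm_galL2 F hν σ (f : (gl 1 E).L2 ν), h, norm_zero]
    exact Subtype.ext (norm_eq_zero.1 hn)
  -- `R(g) (U_σ f) = U_σ (R(σ⁻¹ g) f) = ω_W(σ⁻¹ g) U_σ f`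
  have h1 : (gl 1 E).rightRegular ν g (galL2 F hν σ (f : (gl 1 E).L2 ν)) =
      GLOne.eigenvalue hW (σ⁻¹ • g) • galL2 F hν σ (f : (gl 1 E).L2 ν) := by
    have key := galL2_rightRegular F hν σ (σ⁻¹ • g) (f : (gl 1 E).L2 ν)
    rw [smul_inv_smul] at key
    have hev := congrArg Subtype.val (GLOne.toContRep_apply_eq_eigenvalue_smul hW (σ⁻¹ • g) f)
    change (gl 1 E).rightRegular ν (σ⁻¹ • g) (f : (gl 1 E).L2 ν) =
      GLOne.eigenvalue hW (σ⁻¹ • g) • (f : (gl 1 E).L2 ν) at hev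
    rw [← key, hev, map_smul]
  -- `R(g)` acts on `U_σ(W)` by `ω_{U_σ W}(g)`
  have h2 := congrArg Subtype.val
    (GLOne.toContRep_apply_eq_eigenvalue_smul hW' g ⟨galL2 F hν σ (f : (gl 1 E).L2 ν), hf'⟩)
  change (gl 1 E).rightRegular ν g (galL2 F hν σ (f : (gl 1 E).L2 ν)) =
    GLOne.eigenvalue hW' g • galL2 F hν σ (f : (gl 1 E).L2 ν) at h2
  rw [h1] at h2
  exact (smul_left_injective ℂ hf'0 h2).symm

/-- `σ` acts on the scalar matrix of an idele by acting on the idele: `σ • scalar(x) = scalar(σ • x)`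
(both actions are entrywise through the action of `σ` on `𝔸_E`). [folklore] -/
theorem GLn.smul_scalar_fin_one (σ : E ≃ₐ[F] E) (x : (AdeleRing (𝓞 E) E)ˣ) :
    (σ • (Matrix.GeneralLinearGroup.scalar (Fin 1) x : (gl 1 E).Adelic) : (gl 1 E).Adelic) =
      Matrix.GeneralLinearGroup.scalar (Fin 1) (σ • x) := by
  refine Matrix.GeneralLinearGroup.ext fun i j => ?_
  obtain rfl : i = 0 := Subsingleton.elim _ _
  obtain rfl : j = 0 := Subsingleton.elim _ _
  rfl

/-- **The Hecke character of a Galois conjugate in rank one**: for a cuspidal automorphic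
representation `Π` of `GL_1(𝔸_E)` and `σ ∈ Aut(E/F)`, `χ_{U_σ(Π)}(x) = χ_Π(σ⁻¹ • x)` for every idele
`x` of `E` (`U_σ(Π) ≅ Π ∘ σ⁻¹`; Arthur–Clozel, Ch. 1 §2.1 and Ch. 3 §6: the conjugates `ω^{σ^i}` of
an idèle class character). [cite: ArthurClozelAMS120, Ch. 1 §2.1 (`Π^σ`)] -/
theorem CuspidalAutomorphicRepGL.heckeCharacter_galConj_apply (hν : IsGalInvariant F ν)
    (P : CuspidalAutomorphicRepGL 1 E ν) (σ : E ≃ₐ[F] E) (x : (AdeleRing (𝓞 E) E)ˣ) :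
    (P.galConj F hν σ).heckeCharacter x = P.heckeCharacter (σ⁻¹ • x) := by
  refine Units.ext ?_
  change ((GLOne.heckeCharacter (P.galConj F hν σ).isTopIrreducible x : ℂˣ) : ℂ) =
    ((GLOne.heckeCharacter P.isTopIrreducible (σ⁻¹ • x) : ℂˣ) : ℂ)
  rw [GLOne.coe_heckeCharacter_apply, GLOne.coe_heckeCharacter_apply]
  have key := GLOne.eigenvalue_galConj F hν σ P.isTopIrreducible (P.galConj F hν σ).isTopIrreducible
    (Matrix.GeneralLinearGroup.scalar (Fin 1) x)
  exact key.trans (congrArg _ (GLn.smul_scalar_fin_one F σ⁻¹ x))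

omit [(gl 1 E).IsAutomorphicMeasure ν] in
/-- **`U_σ` carries `K(𝔑)`-fixed vectors to `K(𝔑)`-fixed vectors for a `Gal`-stable level `𝔑`**
(`σ • 𝔑 = 𝔑`, e.g. `𝔑` extended from `F`): `U_σ` maps `W^{K(𝔑)}` onto `U_σ(W)^{σ K(𝔑)}` and
`σ K(𝔑) = K(σ 𝔑) = K(𝔑)` (any rank `n`). [folklore] -/
theorem exists_mem_fixedVectors_galConj {n : ℕ} {ν : Measure (gl n E).automorphicQuotient}
    [SMulInvariantMeasure (gl n E).Adelic (gl n E).automorphicQuotient ν]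
    (hν : IsGalInvariant F ν) (σ : E ≃ₐ[F] E)
    {W : ContRepresentation.ClosedSubrep ((gl n E).rightRegular ν)} {𝔑 : Ideal (𝓞 E)}
    (h𝔑 : σ • 𝔑 = 𝔑) (h : ∃ f ∈ W.fixedVectors (principalCongruenceLevel n E 𝔑), f ≠ 0) :
    ∃ f ∈ (W.galConj hν σ).fixedVectors (principalCongruenceLevel n E 𝔑), f ≠ 0 := by
  obtain ⟨f, hf, hf0⟩ := h
  have he := isConjEquivariant_galL2Equiv F hν σ
  refine ⟨W.mapConjEquiv he f, ?_, fun h0 => hf0 ((W.mapConjEquiv he).injective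
    (h0.trans (map_zero _).symm))⟩
  have key := (W.mapConjEquiv_mem_fixedVectors_iff he (principalCongruenceLevel n E 𝔑) f).2 hf
  rw [map_principalCongruenceLevel F σ 𝔑, h𝔑] at key
  exact key

end GalConj

end Literature.NumberTheory.Automorphic

end
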